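import Summits.AnomalousDissipation.AnomalousDissipation.Theorems.SolenoidalFractalHomogenisationLagrangianStepCellClauseCutsFamily
import HarnessLib

/-!
# K1L `LagrangianRenormalisationStep(Design)` (stmt-AnomalousDissipation-24912 → K1L_D): the CHAIN through the ν-dependent shape FAMILY — window
# propagation along `shapeSeqF` under the interval / sectorial-interval clause with centre defect (helper; `--supports … --as helper`; LANDING LIST F3, part a)

Summits-side helper file of route `SolenoidalFractalHomogenisation` (everything proved; no definitions, no named facts, no sorry).  Landing item F3
(part a: the chain facts) of the tenure planner's LANDING MAP (cell `ad-ideate`, tenure D24-2 (c) / D24-3, STATUS 2026-08-28T13:04:46Z) for the crux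
workfile `Cruxes/LagrangianRenormalisationStep/IntervalWindowFamilySketch.lean` (planner ad-ideate-p4 g9, commit 78e41dd75007, farm rc 0): §3 consumer
facts (`oddSmall_renormStep`, `nearIso_renormStep`, `renormStep_interval`, `shapeSeqF_interval`, `shapeSeqF_image`, `nearIso_of_inInterval_le`,
`chainTensorF_nearIso`, `chainImage_nearIso`) and their §7 sectorial × defect versions (`shapeSeqF_intervalS`, `shapeSeqF_imageS`, `chainTensorF_nearIsoS`,
`chainImage_nearIsoS`), texts VERBATIM in the shared namespace `…Theorems.SolenoidalFractalHomogenisation.LagrangianStep`.  CONTENT: along the family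
shape sequence `S_m = renormStep (Φ (cellVisc (m+1))) g_{m+1} S_{m+1}`, `S_j = I`, the aspect of the S⋆-centred order interval containing `S_m` runs as
`aspF d = λ₀·∏_{i<d} μ(cellVisc (j−i))` (renormStep is a convex combination; the clause maps the interval of aspect `λ` into that of aspect `μλ`);
under the tail bound `aspF ≤ Λc` every chain shape and its `Φ`-image is `OddSmall β ∧ NearIso lo hi` and `NearIso (chainTensorF E Φ j m) (kbar m·lo)
(kbar m·hi)` — the `𝔸`-window conjunct of `ChainLower E` and the two image facts the window-agnostic one-level step `stub_oneLevelL_I` consumes.  The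
glue itself is the sibling `…OneLevelGlueLowerFamilyGlue`.  Infrastructure for route-1's rung leaf F-D1.A0 (a frontier FORMAL rung); NOT a proof of the
crux, of Onsager's conjecture or of anomalous dissipation.  Landed by prover seat `ad-k3l-bookkeeping-p1` g3, 2026-08-28.
-/

set_option linter.dupNamespace false

namespace Summit.AnomalousDissipation.AnomalousDissipation.Theorems.SolenoidalFractalHomogenisation.LagrangianStep

open Literature.Analysis Literature.Analysis.FluidPDE Literature.Analysis.FunctionSpaces
open MeasureTheory Set Filter
open scoped ENNReal NNReal InnerProductSpace

noncomputable section

/-! ## §3 Window propagation along the family shape sequence; the `𝔸`-window conjunct of `ChainLower E` -/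

/-- `renormStep` keeps `OddSmall β` (convex combination; any map). -/
theorem oddSmall_renormStep {Φν : T4 → T4} {β g : ℝ} (hβ : 0 ≤ β) (hg : 0 ≤ g) {S : T4}
    (hSo : Torus.OddSmall S β) (hΦo : Torus.OddSmall (Φν S) β) : Torus.OddSmall (renormStep Φν g S) β := by
  have h := (hSo.add (hΦo.smul g) hβ (mul_nonneg hg hβ)).smul (1 / (1 + g))
  have hne : (1 + g) ≠ 0 := by positivity
  exact oddSmall_congr h (by field_simp)

/-- `renormStep` keeps a `NearIso` band containing `S` and `Φ S` (window-agnostic form of `renormStep_window`). -/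
theorem nearIso_renormStep {Φν : T4 → T4} {lo hi g : ℝ} (hg : 0 ≤ g) {S : T4}
    (hSn : Torus.NearIso S lo hi) (hΦn : Torus.NearIso (Φν S) lo hi) : Torus.NearIso (renormStep Φν g S) lo hi := by
  have hg1 : (0:ℝ) ≤ 1 / (1 + g) := by positivity
  have hne : (1 + g) ≠ 0 := by positivity
  have h := (hSn.add (hΦn.smul hg)).smul hg1
  exact nearIso_congr h (by field_simp) (by field_simp)

/-- `renormStep` keeps every order interval containing `S` and `Φ S` (g4 `renormStep_interval`, any map). -/
theorem renormStep_interval {Φν : T4 → T4} {Sstar : T4} {lam g : ℝ} (hg : 0 ≤ g) {S : T4}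
    (hS : InInterval Sstar lam S) (hΦS : InInterval Sstar lam (Φν S)) :
    InInterval Sstar lam (renormStep Φν g S) := by
  have hg1 : (0:ℝ) ≤ 1 / (1 + g) := by positivity
  have hne : (1 + g) ≠ 0 := by positivity
  have key : ∀ X : T4, (1 / (1 + g)) • (X + g • X) = X := fun X => by
    rw [show X + g • X = (1 + g) • X by rw [add_smul, one_smul], smul_smul, one_div_mul_cancel hne, one_smul]
  constructor
  · have h := ((hS.1.add (hΦS.1.smul hg)).smul hg1)
    rw [key] at h
    exact h
  · have h := ((hS.2.add (hΦS.2.smul hg)).smul hg1)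
    rw [key] at h
    exact h

/-- INDUCTION ALONG THE FAMILY CHAIN.  Under `∀ i, IntervalWindowClause (Ψ i) S⋆ slo shi λ₀ Λ β (μ i)` every shape of depth `d` with running aspect
`aspF μ λ₀ j d ≤ Λ` is `OddSmall β` and lies in `[[S⋆/aspF d, aspF d · S⋆]]`. -/
theorem shapeSeqF_interval {Ψ : ℕ → T4 → T4} {Sstar : T4} {slo shi lam₀ Λ β : ℝ} {μ : ℕ → ℝ}
    (hβ : 0 ≤ β) (hslo : 0 ≤ slo) (hwin : ∀ i, IntervalWindowClause (Ψ i) Sstar slo shi lam₀ Λ β (μ i))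
    (hμ : ∀ i, 1 ≤ μ i) {g : ℕ → ℝ} (hg : ∀ i, 0 ≤ g i) (j : ℕ) :
    ∀ d, aspF μ lam₀ j d ≤ Λ →
      Torus.OddSmall (shapeSeqF Ψ g j d) β ∧ InInterval Sstar (aspF μ lam₀ j d) (shapeSeqF Ψ g j d)
  | 0, _ => ⟨Torus.oddSmall_isoVisc 1 β, (hwin 0).2.2.1⟩
  | d + 1, hΛ => by
      have h0 : (0:ℝ) ≤ lam₀ := zero_le_one.trans (hwin 0).2.1
      have hle : aspF μ lam₀ j d ≤ aspF μ lam₀ j (d + 1) := aspF_le_succ hμ h0 j d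
      obtain ⟨ho, hi'⟩ := shapeSeqF_interval hβ hslo hwin hμ hg j d (hle.trans hΛ)
      have hpos : TransNonneg Sstar := transNonneg_of_nearIso (hwin 0).1 hslo
      have hlam : aspF μ lam₀ j d ∈ Set.Icc lam₀ Λ := ⟨lam₀_le_aspF hμ h0 j d, hle.trans hΛ⟩
      have hlampos : 0 < aspF μ lam₀ j d := lt_of_lt_of_le (lt_of_lt_of_le one_pos (hwin 0).2.1) hlam.1
      obtain ⟨hΦo, hΦi⟩ := (hwin (j - d)).2.2.2 _ hlam _ ho hi'
      exact ⟨oddSmall_renormStep hβ (hg _) ho hΦo, renormStep_interval (hg _) (hi'.mono hpos hlampos hle) hΦi⟩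

/-- … and ONE MORE clause application: the facts about the `Ψ (j-d)`-IMAGE of the depth-`d` shape (what the window-agnostic `stub_oneLevelL_I`
is fed at level `m = j - d - 1`). -/
theorem shapeSeqF_image {Ψ : ℕ → T4 → T4} {Sstar : T4} {slo shi lam₀ Λ β : ℝ} {μ : ℕ → ℝ}
    (hβ : 0 ≤ β) (hslo : 0 ≤ slo) (hwin : ∀ i, IntervalWindowClause (Ψ i) Sstar slo shi lam₀ Λ β (μ i))
    (hμ : ∀ i, 1 ≤ μ i) {g : ℕ → ℝ} (hg : ∀ i, 0 ≤ g i) (j d : ℕ) (hΛ : aspF μ lam₀ j (d + 1) ≤ Λ) :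
    Torus.OddSmall (Ψ (j - d) (shapeSeqF Ψ g j d)) β ∧ InInterval Sstar (aspF μ lam₀ j (d + 1)) (Ψ (j - d) (shapeSeqF Ψ g j d)) := by
  have h0 : (0:ℝ) ≤ lam₀ := zero_le_one.trans (hwin 0).2.1
  have hle : aspF μ lam₀ j d ≤ aspF μ lam₀ j (d + 1) := aspF_le_succ hμ h0 j d
  obtain ⟨ho, hi'⟩ := shapeSeqF_interval hβ hslo hwin hμ hg j d (hle.trans hΛ)
  exact (hwin (j - d)).2.2.2 _ ⟨lam₀_le_aspF hμ h0 j d, hle.trans hΛ⟩ _ ho hi'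

/-- Band of a shape in an interval of aspect `≤ Λc`: `NearIso lo hi` whenever `lo·Λc ≤ slo` and `shi·Λc ≤ hi`. -/
theorem nearIso_of_inInterval_le {Sstar S : T4} {slo shi lam Λc lo hi : ℝ} (hstar : Torus.NearIso Sstar slo shi)
    (hslo : 0 ≤ slo) (hlam1 : 1 ≤ lam) (hlamc : lam ≤ Λc) (hlo : 0 ≤ lo) (hloc : lo * Λc ≤ slo) (hhic : shi * Λc ≤ hi)
    (hS : InInterval Sstar lam S) : Torus.NearIso S lo hi := by
  have hlam0 : 0 < lam := lt_of_lt_of_le one_pos hlam1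
  have hshi : 0 ≤ shi := by
    -- from the interval at any transverse pair: slo ≤ shi follows from hstar where Q > 0; use k = e₀, p = e₁
    set k : Fin 3 → ℝ := fun i => if i = 0 then 1 else 0 with hk
    set p : Fin 3 → ℝ := fun i => if i = 1 then 1 else 0 with hp
    have hkp : ∑ i, p i * k i = 0 := by simp [hk, hp]
    have hQ : (∑ a, k a ^ 2) * (∑ i, p i ^ 2) = 1 := by simp [hk, hp]
    obtain ⟨hl, hh⟩ := hstar k p hkp
    rw [hQ] at hl hh
    linarith
  refine (InInterval.nearIso hlam1 hstar hS).mono ?_ ?_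
  · -- lo ≤ slo/lam  ⟸  lo·lam ≤ lo·Λc ≤ slo
    rw [le_div_iff₀ hlam0]
    exact le_trans (mul_le_mul_of_nonneg_left hlamc hlo) hloc
  · exact le_trans (mul_le_mul_of_nonneg_left hlamc hshi) hhic

/-- **CONSUMER FACT 1 (chain).**  Under the family clause with common centre, defects `μ ≥ 1` and the tail bound from level `m₁` on: for
`m₁ ≤ m ≤ j` the level-`m` shape of the chain below `j` and (for `m₁ ≤ m < j`) the `Φ (cellVisc (m+1))`-image of the level-`(m+1)` shape are
`OddSmall β ∧ NearIso lo hi`, and the level-`m` TENSOR is `NearIso (kbar m·lo) (kbar m·hi)` — the window conjunct of `ChainLower E`. -/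
theorem chainTensorF_nearIso {k : ℕ} (E : LatticeShear.LagrangianLatticeCarrier k)
    {Φ : ℝ → T4 → T4} {Sstar : T4} {slo shi lam₀ Λ β : ℝ} {μ : ℝ → ℝ} {Λc lo hi : ℝ}
    (hβ : 0 ≤ β) (hslo : 0 ≤ slo) (hwin : ∀ ν, IntervalWindowClause (Φ ν) Sstar slo shi lam₀ Λ β (μ ν)) (hμ : ∀ ν, 1 ≤ μ ν)
    (hΛc : Λc ≤ Λ) (hlo : 0 ≤ lo) (hloc : lo * Λc ≤ slo) (hhic : shi * Λc ≤ hi)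
    {m₁ : ℕ} (htail : ∀ j d : ℕ, m₁ + d ≤ j → aspF (fun i => μ (E.cellVisc i)) lam₀ j d ≤ Λc)
    {j m : ℕ} (hm : m₁ ≤ m) (hmj : m ≤ j) :
    (Torus.OddSmall (shapeSeqF (fun i => Φ (E.cellVisc i)) (fun i => E.gain / E.cellVisc i ^ 2) j (j - m)) β ∧
      Torus.NearIso (shapeSeqF (fun i => Φ (E.cellVisc i)) (fun i => E.gain / E.cellVisc i ^ 2) j (j - m)) lo hi) ∧
    Torus.NearIso (chainTensorF E Φ j m) (E.kbar m * lo) (E.kbar m * hi) := by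
  have hwin' : ∀ i, IntervalWindowClause (Φ (E.cellVisc i)) Sstar slo shi lam₀ Λ β (μ (E.cellVisc i)) := fun i => hwin _
  have hμ' : ∀ i, 1 ≤ (fun i => μ (E.cellVisc i)) i := fun i => hμ _
  have hgpos : ∀ i, 0 ≤ E.gain / E.cellVisc i ^ 2 := fun i => div_nonneg E.gain_pos.le (sq_nonneg _)
  have h0 : (0:ℝ) ≤ lam₀ := zero_le_one.trans (hwin 0).2.1
  have hd : m₁ + (j - m) ≤ j := by omega
  have hasp : aspF (fun i => μ (E.cellVisc i)) lam₀ j (j - m) ≤ Λc := htail j (j - m) hd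
  obtain ⟨ho, hi'⟩ := shapeSeqF_interval hβ hslo hwin' hμ' hgpos j (j - m) (hasp.trans hΛc)
  have h1 : 1 ≤ aspF (fun i => μ (E.cellVisc i)) lam₀ j (j - m) := le_trans (hwin 0).2.1 (lam₀_le_aspF hμ' h0 j (j - m))
  have hS : Torus.NearIso (shapeSeqF (fun i => Φ (E.cellVisc i)) (fun i => E.gain / E.cellVisc i ^ 2) j (j - m)) lo hi :=
    nearIso_of_inInterval_le (hwin 0).1 hslo h1 hasp hlo hloc hhic hi'
  exact ⟨⟨ho, hS⟩, hS.smul (E.kbar_pos m).le⟩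

/-- The IMAGE facts fed to `stub_oneLevelL_I` at level `m` (`m₁ ≤ m < j`): `S = ` the level-`(m+1)` shape, `Φ (cellVisc (m+1)) S` is `OddSmall β ∧ NearIso lo hi`. -/
theorem chainImage_nearIso {k : ℕ} (E : LatticeShear.LagrangianLatticeCarrier k)
    {Φ : ℝ → T4 → T4} {Sstar : T4} {slo shi lam₀ Λ β : ℝ} {μ : ℝ → ℝ} {Λc lo hi : ℝ}
    (hβ : 0 ≤ β) (hslo : 0 ≤ slo) (hwin : ∀ ν, IntervalWindowClause (Φ ν) Sstar slo shi lam₀ Λ β (μ ν)) (hμ : ∀ ν, 1 ≤ μ ν)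
    (hΛc : Λc ≤ Λ) (hlo : 0 ≤ lo) (hloc : lo * Λc ≤ slo) (hhic : shi * Λc ≤ hi)
    {m₁ : ℕ} (htail : ∀ j d : ℕ, m₁ + d ≤ j → aspF (fun i => μ (E.cellVisc i)) lam₀ j d ≤ Λc)
    {j m : ℕ} (hm : m₁ ≤ m) (hmj : m < j) :
    Torus.OddSmall (Φ (E.cellVisc (m + 1)) (shapeSeqF (fun i => Φ (E.cellVisc i)) (fun i => E.gain / E.cellVisc i ^ 2) j (j - (m + 1)))) β ∧
    Torus.NearIso (Φ (E.cellVisc (m + 1)) (shapeSeqF (fun i => Φ (E.cellVisc i)) (fun i => E.gain / E.cellVisc i ^ 2) j (j - (m + 1)))) lo hi := by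
  have hwin' : ∀ i, IntervalWindowClause (Φ (E.cellVisc i)) Sstar slo shi lam₀ Λ β (μ (E.cellVisc i)) := fun i => hwin _
  have hμ' : ∀ i, 1 ≤ (fun i => μ (E.cellVisc i)) i := fun i => hμ _
  have hgpos : ∀ i, 0 ≤ E.gain / E.cellVisc i ^ 2 := fun i => div_nonneg E.gain_pos.le (sq_nonneg _)
  have h0 : (0:ℝ) ≤ lam₀ := zero_le_one.trans (hwin 0).2.1
  set d : ℕ := j - (m + 1) with hd_def
  have hjd : j - d = m + 1 := by omega
  have hd1 : m₁ + (d + 1) ≤ j := by omega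
  have hasp : aspF (fun i => μ (E.cellVisc i)) lam₀ j (d + 1) ≤ Λc := htail j (d + 1) hd1
  obtain ⟨ho, hi'⟩ := shapeSeqF_image hβ hslo hwin' hμ' hgpos j d (hasp.trans hΛc)
  rw [hjd] at ho hi'
  have h1 : 1 ≤ aspF (fun i => μ (E.cellVisc i)) lam₀ j (d + 1) := le_trans (hwin 0).2.1 (lam₀_le_aspF hμ' h0 j (d + 1))
  exact ⟨ho, nearIso_of_inInterval_le (hwin 0).1 hslo h1 hasp hlo hloc hhic hi'⟩

/-- INDUCTION ALONG THE FAMILY CHAIN, sectorial × defect.  Under `∀ i, SectorialIntervalWindowClause (Ψ i) S⋆ slo shi λ₀ Λ τlo τhi (μ i)`,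
for every `τ ∈ [τlo, τhi]`, every shape of depth `d` with running aspect `aspF μ λ₀ j d ≤ Λ` is in the sector `τ` and in `[[S⋆/aspF d, aspF d·S⋆]]`. -/
theorem shapeSeqF_intervalS {Ψ : ℕ → T4 → T4} {Sstar : T4} {slo shi lam₀ Λ τlo τhi τ : ℝ} {μ : ℕ → ℝ}
    (hslo : 0 ≤ slo) (hτ : τ ∈ Set.Icc τlo τhi)
    (hwin : ∀ i, SectorialIntervalWindowClause (Ψ i) Sstar slo shi lam₀ Λ τlo τhi (μ i))
    (hμ : ∀ i, 1 ≤ μ i) {g : ℕ → ℝ} (hg : ∀ i, 0 ≤ g i) (j : ℕ) :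
    ∀ d, aspF μ lam₀ j d ≤ Λ →
      OddSectorial (shapeSeqF Ψ g j d) τ ∧ InInterval Sstar (aspF μ lam₀ j d) (shapeSeqF Ψ g j d)
  | 0, _ => ⟨oddSectorial_isoVisc 1 τ, (hwin 0).2.2.1⟩
  | d + 1, hΛ => by
      have hlam₀ : 1 ≤ lam₀ := (hwin 0).2.1
      have h0 : (0:ℝ) ≤ lam₀ := zero_le_one.trans hlam₀
      have hle : aspF μ lam₀ j d ≤ aspF μ lam₀ j (d + 1) := aspF_le_succ hμ h0 j d
      obtain ⟨ho, hi'⟩ := shapeSeqF_intervalS hslo hτ hwin hμ hg j d (hle.trans hΛ)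
      have hpos : TransNonneg Sstar := transNonneg_of_nearIso (hwin 0).1 hslo
      have hlam : aspF μ lam₀ j d ∈ Set.Icc lam₀ Λ := ⟨lam₀_le_aspF hμ h0 j d, hle.trans hΛ⟩
      have hlam1 : 1 ≤ aspF μ lam₀ j d := hlam₀.trans hlam.1
      have hlampos : 0 < aspF μ lam₀ j d := lt_of_lt_of_le one_pos hlam1
      obtain ⟨hΦo, hΦi⟩ := (hwin (j - d)).2.2.2 τ hτ _ hlam _ ho hi'
      have hμlam1 : 1 ≤ μ (j - d) * aspF μ lam₀ j d := one_le_mul_of_one_le_of_one_le (hμ _) hlam1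
      have hSnn : TransNonneg (shapeSeqF Ψ g j d) :=
        transNonneg_of_nearIso (InInterval.nearIso hlam1 (hwin 0).1 hi') (div_nonneg hslo hlampos.le)
      have hΦnn : TransNonneg (Ψ (j - d) (shapeSeqF Ψ g j d)) :=
        transNonneg_of_nearIso (InInterval.nearIso hμlam1 (hwin 0).1 hΦi) (div_nonneg hslo (zero_le_one.trans hμlam1))
      exact ⟨oddSectorial_renormStep (hg _) hSnn hΦnn ho hΦo, renormStep_interval (hg _) (hi'.mono hpos hlampos hle) hΦi⟩

/-- … and one more clause application: the `Ψ (j-d)`-IMAGE of the depth-`d` shape. -/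
theorem shapeSeqF_imageS {Ψ : ℕ → T4 → T4} {Sstar : T4} {slo shi lam₀ Λ τlo τhi τ : ℝ} {μ : ℕ → ℝ}
    (hslo : 0 ≤ slo) (hτ : τ ∈ Set.Icc τlo τhi)
    (hwin : ∀ i, SectorialIntervalWindowClause (Ψ i) Sstar slo shi lam₀ Λ τlo τhi (μ i))
    (hμ : ∀ i, 1 ≤ μ i) {g : ℕ → ℝ} (hg : ∀ i, 0 ≤ g i) (j d : ℕ) (hΛ : aspF μ lam₀ j (d + 1) ≤ Λ) :
    OddSectorial (Ψ (j - d) (shapeSeqF Ψ g j d)) τ ∧ InInterval Sstar (aspF μ lam₀ j (d + 1)) (Ψ (j - d) (shapeSeqF Ψ g j d)) := by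
  have h0 : (0:ℝ) ≤ lam₀ := zero_le_one.trans (hwin 0).2.1
  have hle : aspF μ lam₀ j d ≤ aspF μ lam₀ j (d + 1) := aspF_le_succ hμ h0 j d
  obtain ⟨ho, hi'⟩ := shapeSeqF_intervalS hslo hτ hwin hμ hg j d (hle.trans hΛ)
  exact (hwin (j - d)).2.2.2 τ hτ _ ⟨lam₀_le_aspF hμ h0 j d, hle.trans hΛ⟩ _ ho hi'

/-- **CONSUMER FACT 1 (chain), sectorial × defect.**  Under the family clause, defects `μ ≥ 1`, the tail bound from level `m₁` on and a chain
sector `τc ∈ [τlo, τhi]`, `τc ≥ 0`: for `m₁ ≤ m ≤ j` the level-`m` shape is `OddSmall (τc·hi) ∧ NearIso lo hi` (ABSOLUTE, as `stub_oneLevelL_I`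
wants it) and the level-`m` TENSOR is `NearIso (kbar m·lo) (kbar m·hi)`. -/
theorem chainTensorF_nearIsoS {k : ℕ} (E : LatticeShear.LagrangianLatticeCarrier k)
    {Φ : ℝ → T4 → T4} {Sstar : T4} {slo shi lam₀ Λ τlo τhi τc : ℝ} {μ : ℝ → ℝ} {Λc lo hi : ℝ}
    (hslo : 0 ≤ slo) (hτ : τc ∈ Set.Icc τlo τhi) (hτ0 : 0 ≤ τc)
    (hwin : ∀ ν, SectorialIntervalWindowClause (Φ ν) Sstar slo shi lam₀ Λ τlo τhi (μ ν)) (hμ : ∀ ν, 1 ≤ μ ν)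
    (hΛc : Λc ≤ Λ) (hlo : 0 ≤ lo) (hloc : lo * Λc ≤ slo) (hhic : shi * Λc ≤ hi)
    {m₁ : ℕ} (htail : ∀ j d : ℕ, m₁ + d ≤ j → aspF (fun i => μ (E.cellVisc i)) lam₀ j d ≤ Λc)
    {j m : ℕ} (hm : m₁ ≤ m) (hmj : m ≤ j) :
    (Torus.OddSmall (shapeSeqF (fun i => Φ (E.cellVisc i)) (fun i => E.gain / E.cellVisc i ^ 2) j (j - m)) (τc * hi) ∧
      Torus.NearIso (shapeSeqF (fun i => Φ (E.cellVisc i)) (fun i => E.gain / E.cellVisc i ^ 2) j (j - m)) lo hi) ∧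
    Torus.NearIso (chainTensorF E Φ j m) (E.kbar m * lo) (E.kbar m * hi) := by
  have hwin' : ∀ i, SectorialIntervalWindowClause (Φ (E.cellVisc i)) Sstar slo shi lam₀ Λ τlo τhi (μ (E.cellVisc i)) := fun i => hwin _
  have hμ' : ∀ i, 1 ≤ (fun i => μ (E.cellVisc i)) i := fun i => hμ _
  have hgpos : ∀ i, 0 ≤ E.gain / E.cellVisc i ^ 2 := fun i => div_nonneg E.gain_pos.le (sq_nonneg _)
  have h0 : (0:ℝ) ≤ lam₀ := zero_le_one.trans (hwin 0).2.1
  have hd : m₁ + (j - m) ≤ j := by omega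
  have hasp : aspF (fun i => μ (E.cellVisc i)) lam₀ j (j - m) ≤ Λc := htail j (j - m) hd
  obtain ⟨ho, hi'⟩ := shapeSeqF_intervalS hslo hτ hwin' hμ' hgpos j (j - m) (hasp.trans hΛc)
  have h1 : 1 ≤ aspF (fun i => μ (E.cellVisc i)) lam₀ j (j - m) := le_trans (hwin 0).2.1 (lam₀_le_aspF hμ' h0 j (j - m))
  have hS : Torus.NearIso (shapeSeqF (fun i => Φ (E.cellVisc i)) (fun i => E.gain / E.cellVisc i ^ 2) j (j - m)) lo hi :=
    nearIso_of_inInterval_le (hwin 0).1 hslo h1 hasp hlo hloc hhic hi'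
  exact ⟨⟨ho.oddSmall hS hlo hτ0, hS⟩, hS.smul (E.kbar_pos m).le⟩

/-- The IMAGE facts fed to `stub_oneLevelL_I` at level `m` (`m₁ ≤ m < j`), sectorial × defect. -/
theorem chainImage_nearIsoS {k : ℕ} (E : LatticeShear.LagrangianLatticeCarrier k)
    {Φ : ℝ → T4 → T4} {Sstar : T4} {slo shi lam₀ Λ τlo τhi τc : ℝ} {μ : ℝ → ℝ} {Λc lo hi : ℝ}
    (hslo : 0 ≤ slo) (hτ : τc ∈ Set.Icc τlo τhi) (hτ0 : 0 ≤ τc)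
    (hwin : ∀ ν, SectorialIntervalWindowClause (Φ ν) Sstar slo shi lam₀ Λ τlo τhi (μ ν)) (hμ : ∀ ν, 1 ≤ μ ν)
    (hΛc : Λc ≤ Λ) (hlo : 0 ≤ lo) (hloc : lo * Λc ≤ slo) (hhic : shi * Λc ≤ hi)
    {m₁ : ℕ} (htail : ∀ j d : ℕ, m₁ + d ≤ j → aspF (fun i => μ (E.cellVisc i)) lam₀ j d ≤ Λc)
    {j m : ℕ} (hm : m₁ ≤ m) (hmj : m < j) :
    Torus.OddSmall (Φ (E.cellVisc (m + 1)) (shapeSeqF (fun i => Φ (E.cellVisc i)) (fun i => E.gain / E.cellVisc i ^ 2) j (j - (m + 1)))) (τc * hi) ∧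
    Torus.NearIso (Φ (E.cellVisc (m + 1)) (shapeSeqF (fun i => Φ (E.cellVisc i)) (fun i => E.gain / E.cellVisc i ^ 2) j (j - (m + 1)))) lo hi := by
  have hwin' : ∀ i, SectorialIntervalWindowClause (Φ (E.cellVisc i)) Sstar slo shi lam₀ Λ τlo τhi (μ (E.cellVisc i)) := fun i => hwin _
  have hμ' : ∀ i, 1 ≤ (fun i => μ (E.cellVisc i)) i := fun i => hμ _
  have hgpos : ∀ i, 0 ≤ E.gain / E.cellVisc i ^ 2 := fun i => div_nonneg E.gain_pos.le (sq_nonneg _)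
  have h0 : (0:ℝ) ≤ lam₀ := zero_le_one.trans (hwin 0).2.1
  set d : ℕ := j - (m + 1) with hd_def
  have hjd : j - d = m + 1 := by omega
  have hd1 : m₁ + (d + 1) ≤ j := by omega
  have hasp : aspF (fun i => μ (E.cellVisc i)) lam₀ j (d + 1) ≤ Λc := htail j (d + 1) hd1
  obtain ⟨ho, hi'⟩ := shapeSeqF_imageS hslo hτ hwin' hμ' hgpos j d (hasp.trans hΛc)
  rw [hjd] at ho hi'
  have h1 : 1 ≤ aspF (fun i => μ (E.cellVisc i)) lam₀ j (d + 1) := le_trans (hwin 0).2.1 (lam₀_le_aspF hμ' h0 j (d + 1))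
  have hN : Torus.NearIso (Φ (E.cellVisc (m + 1)) (shapeSeqF (fun i => Φ (E.cellVisc i)) (fun i => E.gain / E.cellVisc i ^ 2) j d)) lo hi :=
    nearIso_of_inInterval_le (hwin 0).1 hslo h1 hasp hlo hloc hhic hi'
  exact ⟨ho.oddSmall hN hlo hτ0, hN⟩

end

end Summit.AnomalousDissipation.AnomalousDissipation.Theorems.SolenoidalFractalHomogenisation.LagrangianStep
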